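import Summits.QuantumFields.YangMills.Theorems.QuantileBitPuritySectors
import HarnessLib

/-!
# Seam sectors: the abstract transport inequality (change of variables by a measure-preserving map of the ring space)

Support module (`--supports` stmt-QuantumFields-23948, `QuantileBitPurity.HolonomyQuantileSubQuartic`; seat ym-dw-p1 g15, plan HOME `bc/g15-dw/PLAN-CORE-GAXIS.md`, module T1).
The domination step of every translate argument, stated ONCE for an arbitrary measurable map `Φ` of the ring space `(slices) × (seam field)` that preserves
the product Haar measure: if `Φ` maps the event `A` into `B` and the seam-closed chain of kernels satisfies `w ≤ C · w ∘ Φ` on `A`, then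

★ `sectorWeight_indicator_le_of_measurePreserving`: `W_z(𝟙_A) ≤ C · W_z(𝟙_B)`.

(The own-axis shift of `ToronSmallBallOwnAxisShiftTranslate` is the special case of a slice-wise map with a Jacobian; the seam-axis sheet shift of the
plan is measure preserving on the nose, and slice- and seam-dependent, which is why the abstract form is needed.)

HONEST FRAMING: fixed-lattice bookkeeping; nothing about infinite volume, the continuum limit or the Clay gap.  No `sorry`, no new axiom, no new
definition.  References: [cite: Luscher1983, §2]; [cite: MontvayMunster1994, (3.145)].
-/

set_option autoImplicit false

noncomputable section

open MeasureTheory Set Function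
open scoped BigOperators
open Literature.MathematicalPhysics.QuantumLattice
open Literature.MathematicalPhysics.QuantumFieldTheory hiding SU2
open Summit.QuantumFields.YangMills.Theorems

namespace Summit.QuantumFields.YangMills.Theorems.FemtoTransferGap.TT

open Summit.QuantumFields.YangMills.Theorems.FemtoTransferGap

variable {L : ℕ} [NeZero L]

/-- ★ **Transport inequality for sector weights.**  Let `Φ` be a measurable self-map of the ring space `(Fin (n+1) → slices) × (seam field)` preserving
`(⊗ Haar) ⊗ Haar`, mapping the event `A` into `B`, with the seam-closed kernel chain `w` satisfying `w(p) ≤ C · w(Φ p)` on `A`.  Then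
`W_z(𝟙_A) ≤ C · W_z(𝟙_B)`. [cite: Luscher1983, §2] -/
theorem sectorWeight_indicator_le_of_measurePreserving (β : ℝ) (n : ℕ) (z : Fin 3 → Bool)
    {Φ : (Fin (n + 1) → GaugeConfig 3 L SU2) × (Site 3 L → SU2) → (Fin (n + 1) → GaugeConfig 3 L SU2) × (Site 3 L → SU2)}
    (hΦ : MeasurePreserving Φ ((Measure.pi fun _ : Fin (n + 1) => configMeasure SU2 L).prod (gaugeMeasure L))
      ((Measure.pi fun _ : Fin (n + 1) => configMeasure SU2 L).prod (gaugeMeasure L)))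
    {A B : Set ((Site 3 L → SU2) × (Fin (n + 1) → GaugeConfig 3 L SU2))} (hA : MeasurableSet A) (hB : MeasurableSet B)
    (hAB : ∀ p : (Fin (n + 1) → GaugeConfig 3 L SU2) × (Site 3 L → SU2), (p.2, p.1) ∈ A → ((Φ p).2, (Φ p).1) ∈ B) {C : ℝ} (hC : 0 ≤ C)
    (hcost : ∀ p : (Fin (n + 1) → GaugeConfig 3 L SU2) × (Site 3 L → SU2), (p.2, p.1) ∈ A →
      (∏ i : Fin n, transferKernel su2Rep β (p.1 i.castSucc) (p.1 i.succ)) *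
          transferKernel su2Rep β (p.1 (Fin.last n)) (gaugeTransform p.2 (twist3 z (p.1 0))) ≤
        C * ((∏ i : Fin n, transferKernel su2Rep β ((Φ p).1 i.castSucc) ((Φ p).1 i.succ)) *
          transferKernel su2Rep β ((Φ p).1 (Fin.last n)) (gaugeTransform (Φ p).2 (twist3 z ((Φ p).1 0))))) :
    sectorWeight β n z (fun Us g => A.indicator (fun _ => (1 : ℝ)) (g, Us)) ≤
      C * sectorWeight β n z (fun Us g => B.indicator (fun _ => (1 : ℝ)) (g, Us)) := by
  -- notation: the product measure, the chain `w`, the two indicator functionals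
  set μ := (Measure.pi fun _ : Fin (n + 1) => configMeasure SU2 L).prod (gaugeMeasure L) with hμ
  set w : (Fin (n + 1) → GaugeConfig 3 L SU2) × (Site 3 L → SU2) → ℝ := fun p =>
    (∏ i : Fin n, transferKernel su2Rep β (p.1 i.castSucc) (p.1 i.succ)) *
      transferKernel su2Rep β (p.1 (Fin.last n)) (gaugeTransform p.2 (twist3 z (p.1 0))) with hw
  have hswap : Measurable fun p : (Fin (n + 1) → GaugeConfig 3 L SU2) × (Site 3 L → SU2) => (p.2, p.1) := measurable_swap
  have hFA : Measurable (uncurry fun (Us : Fin (n + 1) → GaugeConfig 3 L SU2) (g : Site 3 L → SU2) => A.indicator (fun _ => (1 : ℝ)) (g, Us)) :=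
    (measurable_const.indicator hA).comp hswap
  have hFB : Measurable (uncurry fun (Us : Fin (n + 1) → GaugeConfig 3 L SU2) (g : Site 3 L → SU2) => B.indicator (fun _ => (1 : ℝ)) (g, Us)) :=
    (measurable_const.indicator hB).comp hswap
  have hbA : ∀ (Us : Fin (n + 1) → GaugeConfig 3 L SU2) (g : Site 3 L → SU2), |A.indicator (fun _ => (1 : ℝ)) (g, Us)| ≤ 1 :=
    fun Us g => abs_indicator_one_le _ _
  have hbB : ∀ (Us : Fin (n + 1) → GaugeConfig 3 L SU2) (g : Site 3 L → SU2), |B.indicator (fun _ => (1 : ℝ)) (g, Us)| ≤ 1 :=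
    fun Us g => abs_indicator_one_le _ _
  rw [sectorWeight_eq_integral_prod β n z hFA hbA, sectorWeight_eq_integral_prod β n z hFB hbB]
  -- the two integrands as functions on the product
  have hwm : Measurable w := by
    have h := measurable_sectorIntegrand (L := L) β n z (F := fun _ _ => (1 : ℝ)) measurable_const
    have e : w = uncurry fun (Us : Fin (n + 1) → GaugeConfig 3 L SU2) (g : Site 3 L → SU2) =>
        (∏ i : Fin n, transferKernel su2Rep β (Us i.castSucc) (Us i.succ)) *
          transferKernel su2Rep β (Us (Fin.last n)) (gaugeTransform g (twist3 z (Us 0))) * (1 : ℝ) := by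
      funext p; simp only [hw, uncurry, mul_one]
    rw [e]; exact h
  have hw0 : ∀ p, 0 ≤ w p := fun p => seamChain_nonneg β n z p.1 p.2
  set fB : (Fin (n + 1) → GaugeConfig 3 L SU2) × (Site 3 L → SU2) → ℝ := fun p => w p * B.indicator (fun _ => (1 : ℝ)) (p.2, p.1) with hfB
  have hintA : Integrable (fun p : (Fin (n + 1) → GaugeConfig 3 L SU2) × (Site 3 L → SU2) => w p * A.indicator (fun _ => (1 : ℝ)) (p.2, p.1)) μ :=
    integrable_sectorIntegrand (L := L) β n z hFA hbA
  have hintB : Integrable fB μ := integrable_sectorIntegrand (L := L) β n z hFB hbB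
  -- change of variables for the dominating integrand
  have hcomp : Integrable (fB ∘ Φ) μ := (hΦ.integrable_comp hintB.aestronglyMeasurable).2 hintB
  have hcov : ∫ p, fB (Φ p) ∂μ = ∫ p, fB p ∂μ := by
    have hsm : AEStronglyMeasurable fB (Measure.map Φ μ) := by rw [hΦ.map_eq]; exact hintB.aestronglyMeasurable
    have h := integral_map hΦ.measurable.aemeasurable hsm
    rw [hΦ.map_eq] at h
    exact h.symm
  -- pointwise domination on the product space
  have hpt : ∀ p : (Fin (n + 1) → GaugeConfig 3 L SU2) × (Site 3 L → SU2),
      w p * A.indicator (fun _ => (1 : ℝ)) (p.2, p.1) ≤ C * (fB ∘ Φ) p := by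
    intro p
    by_cases hp : (p.2, p.1) ∈ A
    · have hBp : ((Φ p).2, (Φ p).1) ∈ B := hAB p hp
      simp only [Function.comp, hfB, Set.indicator_of_mem hp, Set.indicator_of_mem hBp, mul_one]
      exact hcost p hp
    · simp only [Set.indicator_of_notMem hp, mul_zero, Function.comp, hfB]
      exact mul_nonneg hC (mul_nonneg (hw0 _) (Set.indicator_nonneg (fun _ _ => zero_le_one) _))
  show ∫ p, w p * A.indicator (fun _ => (1 : ℝ)) (p.2, p.1) ∂μ ≤ C * ∫ p, fB p ∂μ
  calc ∫ p, w p * A.indicator (fun _ => (1 : ℝ)) (p.2, p.1) ∂μ ≤ ∫ p, C * (fB ∘ Φ) p ∂μ :=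
        integral_mono hintA (hcomp.const_mul C) hpt
    _ = C * ∫ p, fB p ∂μ := by rw [integral_const_mul, ← hcov]; rfl

end Summit.QuantumFields.YangMills.Theorems.FemtoTransferGap.TT

end
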